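import Summits.Parity.GeneralizedHardyLittlewood.Theorems.PrimeLevelFamEdgeIdeaDeltasFloorDualDecay
import HarnessLib

/-!
# Route `PrimeLevelFamEdge` — TYPED IDEA DELTAS, deck 18d: K-L21-3 — THE AH¼ WITNESS PAIR AS EXPLICIT MEASURES (construction
# half of `QuarterWitnessExistsQD`): `quarterRho = Σ_{k≥2} c_k (δ_{k/4} + δ_{−k/4})`, `quarterNu` = beyond-band density
# + `Σ_{j≠0} δ_{4j}` + `b Σ_j δ_{4j+2}`; PROVED `quarterRho_core`, `quarterNu_offDiag`, `quarterNu_floor`; the ONE analytic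
# input left is the Montgomery/Poisson identity `QuarterParseval` (typed, NOT proved; PSF on `¼ℤ` for the quadratic-decay class —
# Mathlib `Real.tsum_eq_tsum_fourier_of_rpow_decay` is the expected route), tameness `QuarterTame` (PROVED in deck 18e).
# Seat ls-idea-lens-21 g2, `Sketch_L21_DualWitness.lean` v1.4 sha16 50f29e45c9970095 l.436–605 VERBATIM up to the namespace and
# the QD renaming of deck 18c (critic F b26.5: v1.4 VERIFIED, explicit-measure read, `QuarterParseval` NON-VACUOUS and «true on
# paper for this binder»); typer ls-idea-typ-1 gen 3.  HONESTY: measure bookkeeping about an explicit lattice/periodic pair —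
# nothing about ζ; no exceptional-zero theorem (no Landau–Siegel / Siegel-zero exclusion, no Theorem 1–2 of arXiv:2211.02515,
# no repaired Margin232) is proved; typed ≠ proved.
-/

namespace Summit.Parity.GeneralizedHardyLittlewood.Theorems.PrimeLevelFamEdgeIdeaDeltas.FloorDual

open Literature.NumberTheory.LFunctions MeasureTheory
open scoped Real

/-! ### v1.4 · THE AH¼ WITNESS PAIR AS EXPLICIT MEASURES (construction half of `QuarterWitnessExistsQD`)

`quarterRho = Σ_{k≥2} c_k (δ_{k/4} + δ_{−k/4})` (literally the measure named in `QuarterWitnessExistsQD`) and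
`quarterNu =` (beyond-band density) `+ Σ_{j≠0} δ_{4j} + b Σ_j δ_{4j+2}`, where the density is `0` on
`|α| ≤ 1`, the core image `|α − 4j|` on `|α − 4j| ≤ 1` (`j ≠ 0`), and the level `t` elsewhere.  PROVED:
`core`, `offDiag`, `floor`.  The Montgomery/Poisson identity is isolated as `QuarterParseval` and tameness
as `QuarterTame`; `quarterWitnessExists_of` assembles. -/

/-- Nearest point of `4ℤ` below-centred: `4⌊(α+2)/4⌋`. -/
noncomputable def nearestFour (α : ℝ) : ℝ := 4 * (⌊(α + 2) / 4⌋ : ℤ)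

/-- Beyond-band density of the 4-periodic AH¼ form factor. -/
noncomputable def quarterDensity (α : ℝ) : ℝ :=
  if |α| ≤ 1 then 0 else if |α - nearestFour α| ≤ 1 then |α - nearestFour α| else quarterLevel

/-- `ρ₂` of AH¼. -/
noncomputable def quarterRho : Measure ℝ :=
  Measure.sum fun k : ℕ =>
    (ENNReal.ofReal (quarterCoeff (k + 2))) •
      (Measure.dirac ((k + 2 : ℝ) / 4) + Measure.dirac (-((k + 2 : ℝ) / 4)))

/-- `ν` of AH¼ (form factor beyond the diagonal). -/
noncomputable def quarterNu : Measure ℝ :=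
  volume.withDensity (fun α => ENNReal.ofReal (quarterDensity α)) +
    ((Measure.sum fun j : ℤ => if j = 0 then (0 : Measure ℝ) else Measure.dirac (4 * (j : ℝ))) +
      Measure.sum fun j : ℤ => (ENNReal.ofReal quarterAtom) • Measure.dirac (4 * (j : ℝ) + 2))

/-- The beyond-band density is non-negative. -/
theorem quarterDensity_nonneg (α : ℝ) : 0 ≤ quarterDensity α := by
  unfold quarterDensity
  split_ifs with h1 h2
  · exact le_rfl
  · exact abs_nonneg _
  · exact le_trans (by norm_num) seven_tenths_le_quarterLevel

/-- The density vanishes on `|α| ≤ 1`. -/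
theorem quarterDensity_of_abs_le {α : ℝ} (h : |α| ≤ 1) : quarterDensity α = 0 := by
  simp [quarterDensity, h]

/-- On `1 < |α| < 3` the density is the level `t`. -/
theorem quarterDensity_of_mem {α : ℝ} (h1 : 1 < |α|) (h3 : |α| < 3) :
    quarterDensity α = quarterLevel := by
  have hα : α < -1 ∨ 1 < α := by
    rcases le_or_gt 0 α with h | h
    · right; rwa [abs_of_nonneg h] at h1
    · left; rw [abs_of_neg h] at h1; linarith
  have hα3 : -3 < α ∧ α < 3 := abs_lt.mp h3
  unfold quarterDensity
  rw [if_neg (not_le.mpr h1)]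
  have key : 1 < |α - nearestFour α| := by
    unfold nearestFour
    rcases hα with hneg | hpos
    · -- α ∈ (-3,-1)
      rcases lt_or_ge α (-2) with h2 | h2
      · have : ⌊(α + 2) / 4⌋ = -1 := by
          rw [Int.floor_eq_iff]; constructor <;> push_cast <;> linarith [hα3.1]
        rw [this]; push_cast
        rw [abs_of_nonneg (by linarith [hα3.1])]; linarith
      · have : ⌊(α + 2) / 4⌋ = 0 := by
          rw [Int.floor_eq_iff]; constructor <;> push_cast <;> linarith
        rw [this]; push_cast
        rw [abs_of_nonpos (by linarith)]; linarith
    · -- α ∈ (1,3)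
      rcases lt_or_ge α 2 with h2 | h2
      · have : ⌊(α + 2) / 4⌋ = 0 := by
          rw [Int.floor_eq_iff]; constructor <;> push_cast <;> linarith
        rw [this]; push_cast
        rw [abs_of_nonneg (by linarith)]; linarith
      · have : ⌊(α + 2) / 4⌋ = 1 := by
          rw [Int.floor_eq_iff]; constructor <;> push_cast <;> linarith [hα3.2]
        rw [this]; push_cast
        rw [abs_of_nonpos (by linarith [hα3.2])]; linarith [hα3.2]
  rw [if_neg (not_le.mpr key)]

/-- CORE: no pair mass on `|u| < ½`. -/
theorem quarterRho_core : quarterRho (Set.Ioo (-(1 / 2 : ℝ)) (1 / 2)) = 0 := by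
  unfold quarterRho
  rw [Measure.sum_apply _ measurableSet_Ioo]
  have h : ∀ k : ℕ, ((k + 2 : ℝ) / 4) ∉ Set.Ioo (-(1 / 2 : ℝ)) (1 / 2) := by
    intro k hk
    have := hk.2
    have hk0 : (0 : ℝ) ≤ k := Nat.cast_nonneg k
    linarith
  have h' : ∀ k : ℕ, (-((k + 2 : ℝ) / 4)) ∉ Set.Ioo (-(1 / 2 : ℝ)) (1 / 2) := by
    intro k hk
    have := hk.1
    have hk0 : (0 : ℝ) ≤ k := Nat.cast_nonneg k
    linarith
  refine ENNReal.tsum_eq_zero.mpr fun k => ?_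
  rw [Measure.smul_apply, Measure.coe_add, Pi.add_apply, Measure.dirac_apply' _ measurableSet_Ioo,
    Measure.dirac_apply' _ measurableSet_Ioo, Set.indicator_of_notMem (h k),
    Set.indicator_of_notMem (h' k), add_zero, smul_zero]

/-- OFF-DIAGONAL: `ν` has no mass on `[−1,1]`. -/
theorem quarterNu_offDiag : quarterNu (Set.Icc (-1 : ℝ) 1) = 0 := by
  unfold quarterNu
  simp only [Measure.coe_add, Pi.add_apply]
  have hA : volume.withDensity (fun α => ENNReal.ofReal (quarterDensity α)) (Set.Icc (-1 : ℝ) 1) = 0 := by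
    rw [withDensity_apply _ measurableSet_Icc]
    have : ∀ α ∈ Set.Icc (-1 : ℝ) 1, ENNReal.ofReal (quarterDensity α) = 0 := by
      intro α hα
      rw [quarterDensity_of_abs_le (abs_le.mpr ⟨hα.1, hα.2⟩), ENNReal.ofReal_zero]
    rw [setLIntegral_congr_fun measurableSet_Icc this, lintegral_zero]
  have hB : (Measure.sum fun j : ℤ => if j = 0 then (0 : Measure ℝ) else Measure.dirac (4 * (j : ℝ)))
      (Set.Icc (-1 : ℝ) 1) = 0 := by
    rw [Measure.sum_apply _ measurableSet_Icc]
    refine ENNReal.tsum_eq_zero.mpr fun j => ?_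
    by_cases hj : j = 0
    · simp [hj]
    · rw [if_neg hj, Measure.dirac_apply' _ measurableSet_Icc, Set.indicator_of_notMem]
      intro hmem
      rcases hmem with ⟨h1, h2⟩
      have : (j : ℝ) ≤ -1 ∨ (1 : ℝ) ≤ j := by
        rcases lt_or_gt_of_ne hj with h | h
        · left; exact_mod_cast Int.le_sub_one_of_lt h
        · right; exact_mod_cast h
      rcases this with h | h <;> linarith
  have hC : (Measure.sum fun j : ℤ => (ENNReal.ofReal quarterAtom) • Measure.dirac (4 * (j : ℝ) + 2))
      (Set.Icc (-1 : ℝ) 1) = 0 := by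
    rw [Measure.sum_apply _ measurableSet_Icc]
    refine ENNReal.tsum_eq_zero.mpr fun j => ?_
    rw [Measure.smul_apply, Measure.dirac_apply' _ measurableSet_Icc, Set.indicator_of_notMem, smul_zero]
    intro hmem
    rcases hmem with ⟨h1, h2⟩
    rcases le_or_gt 0 j with h | h
    · have : (0 : ℝ) ≤ j := by exact_mod_cast h
      linarith
    · have : (j : ℝ) ≤ -1 := by exact_mod_cast Int.le_sub_one_of_lt h
      linarith
  rw [hA, hB, hC]; simp

/-- FLOOR: `t · Lebesgue ≤ ν` on `1 < |α| < 3`. -/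
theorem quarterNu_floor :
    (ENNReal.ofReal quarterLevel) • (volume.restrict (Set.Ioo (1 : ℝ) 3 ∪ Set.Ioo (-3) (-1)))
      ≤ quarterNu := by
  have hS : MeasurableSet (Set.Ioo (1 : ℝ) 3 ∪ Set.Ioo (-3) (-1)) :=
    measurableSet_Ioo.union measurableSet_Ioo
  have hle : (ENNReal.ofReal quarterLevel) • (volume.restrict (Set.Ioo (1 : ℝ) 3 ∪ Set.Ioo (-3) (-1)))
      ≤ volume.withDensity (fun α => ENNReal.ofReal (quarterDensity α)) := by
    rw [Measure.le_iff]
    intro s hs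
    rw [Measure.smul_apply, Measure.restrict_apply hs, withDensity_apply _ hs, smul_eq_mul]
    calc ENNReal.ofReal quarterLevel * volume (s ∩ (Set.Ioo (1 : ℝ) 3 ∪ Set.Ioo (-3) (-1)))
        = ∫⁻ α in s ∩ (Set.Ioo (1 : ℝ) 3 ∪ Set.Ioo (-3) (-1)), ENNReal.ofReal quarterLevel := by
          rw [setLIntegral_const]
      _ = ∫⁻ α in s ∩ (Set.Ioo (1 : ℝ) 3 ∪ Set.Ioo (-3) (-1)), ENNReal.ofReal (quarterDensity α) := by
          refine setLIntegral_congr_fun (hs.inter hS) fun α hα => ?_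
          have hα' := hα.2
          have h13 : 1 < |α| ∧ |α| < 3 := by
            rcases hα' with ⟨h1, h3⟩ | ⟨h3, h1⟩
            · rw [abs_of_pos (by linarith)]; exact ⟨h1, h3⟩
            · rw [abs_of_neg (by linarith)]; exact ⟨by linarith, by linarith⟩
          rw [quarterDensity_of_mem h13.1 h13.2]
      _ ≤ ∫⁻ α in s, ENNReal.ofReal (quarterDensity α) :=
          lintegral_mono_set Set.inter_subset_left
  unfold quarterNu
  exact le_trans hle (Measure.le_add_right le_rfl)

/-- The Montgomery/Poisson identity for the explicit pair (the one analytic input left; Poisson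
summation on `¼ℤ` for the quadratic-decay class + Fourier inversion + four trig integrals). -/
def QuarterParseval : Prop :=
  ∀ r : ℝ → ℝ, (∀ u, r (-u) = r u) → Continuous r → Integrable r →
    (∃ C : ℝ, ∀ u : ℝ, |r u| ≤ C / (1 + u ^ 2)) →
    (∃ C : ℝ, ∀ α : ℝ, |BGMM2023.cosTransform r α| ≤ C / (1 + α ^ 2)) →
    Integrable r quarterRho → Integrable (BGMM2023.cosTransform r) quarterNu →
      r 0 + ∫ u, r u ∂quarterRho =
        BGMM2023.cosTransform r 0 + (2 * ∫ α in (0 : ℝ)..1, α * BGMM2023.cosTransform r α)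
          + ∫ α, BGMM2023.cosTransform r α ∂quarterNu

/-- Tameness of the explicit pair (integrability of the decay class against `quarterRho`, `quarterNu`). -/
def QuarterTame : Prop := IsTameWitness quarterRho quarterNu


end Summit.Parity.GeneralizedHardyLittlewood.Theorems.PrimeLevelFamEdgeIdeaDeltas.FloorDual
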